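import Literature.NumberTheory.CubicFields.ReducibleCubicRings
import Literature.NumberTheory.CubicFields.DavenportHeilbronnMaximalityConverse
import Mathlib.Algebra.Squarefree.Basic
import Mathlib.Data.Nat.Squarefree
import HarnessLib

/-!
# Maximal reducible cubic rings ↔ fundamental discriminants (BTT Prop. 4.2, the reducible rings)

Topic `Literature/NumberTheory/CubicFields`, continuing `ReducibleCubicRings.lean` (a maximal,
reducible, nondegenerate `R(f)` has `f ~ (0, 1, c, d)` with `c ∈ {0,1}`, `Disc = c² − 4d`, and
`R((0,1,c,d)) ≅ ℤ × ℤ[t]/(t² + ct + d)`) and `DavenportHeilbronnMaximality(Converse).lean`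
(`IsMaximal f ⇔ f ∈ U_p ∀ p`).

Bhargava–Taniguchi–Thorne 2023, §4 (reducible rings; Prop. 4.2 counts the reducible maximal cubic
rings of discriminant `0 < ±D < X` by the number `N₂^±(X)` of quadratic fields, i.e. of
fundamental discriminants): the maximal reducible nondegenerate cubic rings are `ℤ × 𝓞_K` for the
quadratic fields `K` together with `ℤ × ℤ × ℤ`, one for each fundamental discriminant `D` and for
`D = 1`. Here, with "fundamental discriminant" spelled out as in
`Literature/NumberTheory/QuadraticFields/ThreeTorsionMean.lean` / `FundamentalDiscriminant.lean`
(`D ≡ 1 (4)` squarefree `≠ 1`, or `D = 4m`, `m ≡ 2, 3 (4)` squarefree):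

* `BinaryCubic.disc_emod_four` — Stickelberger for forms: `Disc(f) ≡ 0, 1 (mod 4)`;
* `BinaryCubic.disc_eq_sq_mul_of_sq_dvd_a` — if `p² ∣ a`, `p ∣ b` then `Disc(f) = p² · Disc(f')`
  for an integral form `f'` (so `Disc/p² ≡ 0, 1 (mod 4)`);
* `Int.not_isFundamental_of_eq_sq_mul`, `Int.exists_prime_sq_dvd_of_not_isFundamental` — a
  fundamental discriminant is not `p² E` with `E ≡ 0,1 (4)`, and a non-fundamental discriminant
  `D ≡ 0, 1 (4)`, `D ∉ {0, 1}` is;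
* `RingOfForm.memU_reducibleNormalForm`, `RingOfForm.not_memU_reducibleNormalForm` — `(0,1,c,d) ∈ U_p`
  for all `p` iff `c² − 4d` is fundamental or `1` (the explicit translate
  `(p² q, p c', 1, 0) ~ (0, 1, c, d)` when `c² − 4d = p² E`);
* `RingOfForm.isMaximal_reducibleNormalForm_iff` — **`R((0,1,c,d))` is maximal iff `c² − 4d` is a
  fundamental discriminant or `1`**;
* `RingOfForm.isFundamental_disc_of_isMaximal` — **a maximal reducible nondegenerate `R(f)` has
  `Disc(f)` fundamental or `= 1`**, and `RingOfForm.gl2zEquiv_of_isMaximal_of_disc_eq` — two such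
  forms with the same discriminant are `GL₂(ℤ)`-equivalent; `RingOfForm.exists_isMaximal_reducible_of_isFundamental`
  — every fundamental `D` (and `D = 1`) occurs. So **the `GL₂(ℤ)`-orbits of maximal reducible
  nondegenerate forms are in bijection with {fundamental discriminants} ∪ {1} via `Disc`**
  (BTT Prop. 4.2: their number with `0 < ±Disc < X` is `N₂^±(X) + O(1)`).

## References

* M. Bhargava, T. Taniguchi, F. Thorne, *Improved error estimates for the Davenport–Heilbronn
  theorems*, Math. Ann. 389 (2024) = arXiv:2107.12819, §4, Prop. 4.2 [BhargavaTaniguchiThorne2023].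
* M. Bhargava, A. Shankar, J. Tsimerman, *On the Davenport–Heilbronn theorems and second order
  terms*, Invent. Math. 193 (2013), §2–3 [BhargavaShankarTsimerman2012].
-/

namespace Literature.NumberTheory.CubicFields

open BinaryCubic

/-! ### Arithmetic helpers -/

/-- `c² ≡ c (mod 2)`. [folklore] -/
theorem Int.sq_emod_two (c : ℤ) : c ^ 2 % 2 = c % 2 := by
  rcases Int.even_or_odd c with ⟨k, rfl⟩ | ⟨k, rfl⟩ <;> ring_nf <;> omega

/-- Squares are `0` or `1 (mod 4)`. [folklore] -/
theorem Int.sq_emod_four (s : ℤ) : s ^ 2 % 4 = 0 ∨ s ^ 2 % 4 = 1 := by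
  rcases Int.even_or_odd s with ⟨k, rfl⟩ | ⟨k, rfl⟩ <;> ring_nf <;> omega

/-- An odd square is `1 (mod 4)`. [folklore] -/
theorem Int.sq_emod_four_of_odd {s : ℤ} (hs : s % 2 = 1) : s ^ 2 % 4 = 1 := by
  rcases Int.even_or_odd s with ⟨k, rfl⟩ | ⟨k, rfl⟩
  · omega
  · ring_nf; omega

/-- A squarefree integer is not divisible by the square of a prime. [folklore] -/
theorem Int.not_sq_dvd_of_squarefree {m : ℤ} (hm : Squarefree m) {p : ℕ} (hp : p.Prime) : ¬ (p : ℤ) ^ 2 ∣ m := by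
  intro h
  have hu : IsUnit (p : ℤ) := hm p (by rwa [← sq])
  rw [Int.isUnit_iff_natAbs_eq, Int.natAbs_natCast] at hu
  exact hp.one_lt.ne' hu

/-- A non-squarefree nonzero integer is divisible by the square of a prime. [folklore] -/
theorem Int.exists_prime_sq_dvd_of_not_squarefree {m : ℤ} (hm : ¬ Squarefree m) :
    ∃ p : ℕ, p.Prime ∧ (p : ℤ) ^ 2 ∣ m := by
  rw [← Int.squarefree_natAbs, Nat.squarefree_iff_prime_squarefree] at hm
  push Not at hm
  obtain ⟨p, hp, hdvd⟩ := hm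
  refine ⟨p, hp, ?_⟩
  rw [sq, ← Nat.cast_mul, Int.natCast_dvd]
  exact hdvd

/-! ### Discriminants modulo `4` -/

namespace BinaryCubic

/-- **Stickelberger for binary cubic forms**: `Disc(f) ≡ 0` or `1 (mod 4)`
(`Disc ≡ (bc + ad)² (mod 4)`). [folklore] -/
theorem disc_emod_four (f : BinaryCubic ℤ) : f.disc % 4 = 0 ∨ f.disc % 4 = 1 := by
  have h : f.disc = (f.b * f.c + f.a * f.d) ^ 2 + 4 * (-(f.a * f.c ^ 3) - f.b ^ 3 * f.d - 7 * f.a ^ 2 * f.d ^ 2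
      + 4 * f.a * f.b * f.c * f.d) := by
    rw [disc_eq]; ring
  rcases Int.sq_emod_four (f.b * f.c + f.a * f.d) with h0 | h0 <;> omega

/-- If `p² ∣ a` and `p ∣ b`, say `f = (p²a', pb', c, d)`, then `Disc(f) = p² · Disc(a', b', c, pd)`
(the discriminant of the index-`p` overring). [folklore] -/
theorem disc_eq_sq_mul_of_sq_dvd_a (p a' b' c d : ℤ) :
    (⟨p ^ 2 * a', p * b', c, d⟩ : BinaryCubic ℤ).disc = p ^ 2 * (⟨a', b', c, p * d⟩ : BinaryCubic ℤ).disc := by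
  rw [disc_eq, disc_eq]; ring

/-- Hence if `p² ∣ a`, `p ∣ b` then `Disc(f) = p² E` with `E ≡ 0, 1 (mod 4)`. [folklore] -/
theorem exists_disc_eq_sq_mul {f : BinaryCubic ℤ} {p : ℤ} (hpa : p ^ 2 ∣ f.a) (hpb : p ∣ f.b) :
    ∃ E : ℤ, f.disc = p ^ 2 * E ∧ (E % 4 = 0 ∨ E % 4 = 1) := by
  obtain ⟨a', ha⟩ := hpa
  obtain ⟨b', hb⟩ := hpb
  have hf : f = ⟨p ^ 2 * a', p * b', f.c, f.d⟩ := BinaryCubic.ext ha hb rfl rfl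
  refine ⟨(⟨a', b', f.c, p * f.d⟩ : BinaryCubic ℤ).disc, ?_, disc_emod_four _⟩
  conv_lhs => rw [hf]
  exact disc_eq_sq_mul_of_sq_dvd_a p a' b' f.c f.d

end BinaryCubic

/-! ### Fundamental discriminants and square factors -/

/-- **A fundamental discriminant is not `p² E` with `E ≡ 0, 1 (mod 4)`** (`p` prime): in the odd
case `p² ∤ D`; in the even case `D = 4m` an odd `p` would give `p² ∣ m`, and `p = 2` would give
`m = E ≡ 0, 1 (mod 4)`. [folklore] -/
theorem Int.not_isFundamental_of_eq_sq_mul {D E : ℤ} {p : ℕ} (hp : p.Prime) (hD : D = (p : ℤ) ^ 2 * E)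
    (hE : E % 4 = 0 ∨ E % 4 = 1) :
    ¬ ((D % 4 = 1 ∧ Squarefree D ∧ D ≠ 1) ∨ (4 ∣ D ∧ (D / 4 % 4 = 2 ∨ D / 4 % 4 = 3) ∧ Squarefree (D / 4))) := by
  rintro (⟨-, hsq, -⟩ | ⟨h4, hm, hsq⟩)
  · exact Int.not_sq_dvd_of_squarefree hsq hp ⟨E, hD⟩
  · by_cases hp2 : p = 2
    · subst hp2
      have hm' : D / 4 = E := by rw [hD]; norm_num
      rw [hm'] at hm
      omega
    · -- `p` odd: `p² ∣ D/4`
      have hodd : (p : ℤ) % 2 = 1 := by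
        have := hp.eq_one_or_self_of_dvd 2
        have h2 : ¬ 2 ∣ p := fun h => hp2 ((this h).resolve_left (by norm_num)).symm
        omega
      obtain ⟨m, hm4⟩ := h4
      have hmD : D / 4 = m := by rw [hm4]; exact Int.mul_ediv_cancel_left m four_ne_zero
      rw [hmD] at hsq
      apply Int.not_sq_dvd_of_squarefree hsq hp
      -- from `4 m = p² E` with `p` odd: `4 ∣ E` and `m = p² (E/4)`
      have hsq4 := Int.sq_emod_four_of_odd hodd
      have hE4 : 4 ∣ E := by
        have h : (4 : ℤ) ∣ (p : ℤ) ^ 2 * E := ⟨m, by rw [← hD, hm4]⟩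
        have hcop : IsCoprime (4 : ℤ) ((p : ℤ) ^ 2) := by
          obtain ⟨q, hq⟩ : ∃ q, (p : ℤ) ^ 2 = 4 * q + 1 := ⟨(p : ℤ) ^ 2 / 4, by omega⟩
          exact ⟨-q, 1, by rw [hq]; ring⟩
        exact hcop.dvd_of_dvd_mul_left h
      obtain ⟨E', rfl⟩ := hE4
      refine ⟨E', ?_⟩
      have : 4 * m = 4 * ((p : ℤ) ^ 2 * E') := by rw [← hm4, hD]; ring
      linarith

/-- **A non-fundamental discriminant has a removable square factor**: if `D ≡ 0, 1 (mod 4)`,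
`D ∉ {0, 1}` and `D` is not fundamental then `D = p² E` for a prime `p` and `E ≡ 0, 1 (mod 4)`. [folklore] -/
theorem Int.exists_prime_sq_dvd_of_not_isFundamental {D : ℤ} (h4 : D % 4 = 0 ∨ D % 4 = 1) (h1 : D ≠ 1)
    (hnf : ¬ ((D % 4 = 1 ∧ Squarefree D ∧ D ≠ 1) ∨ (4 ∣ D ∧ (D / 4 % 4 = 2 ∨ D / 4 % 4 = 3) ∧ Squarefree (D / 4)))) :
    ∃ p : ℕ, p.Prime ∧ ∃ E : ℤ, D = (p : ℤ) ^ 2 * E ∧ (E % 4 = 0 ∨ E % 4 = 1) := by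
  rcases h4 with h0 | h1'
  · -- `D = 4m`
    obtain ⟨m, rfl⟩ : 4 ∣ D := Int.dvd_of_emod_eq_zero h0
    have hm : 4 * m / 4 = m := Int.mul_ediv_cancel_left m four_ne_zero
    have hm4 : m % 4 = 0 ∨ m % 4 = 1 ∨ m % 4 = 2 ∨ m % 4 = 3 := by omega
    rcases hm4 with hm0 | hm1 | hm23
    · exact ⟨2, Nat.prime_two, m, by norm_num, Or.inl hm0⟩
    · exact ⟨2, Nat.prime_two, m, by norm_num, Or.inr hm1⟩
    · -- `m ≡ 2, 3 (mod 4)` and not squarefree (else `D` would be fundamental)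
      have hnsq : ¬ Squarefree m := by
        intro hsq
        exact hnf (Or.inr ⟨dvd_mul_right 4 m, by rw [hm]; omega, by rwa [hm]⟩)
      obtain ⟨p, hp, q, hq⟩ := Int.exists_prime_sq_dvd_of_not_squarefree hnsq
      refine ⟨p, hp, 4 * q, by rw [hq]; ring, Or.inl (by omega)⟩
  · -- `D ≡ 1 (mod 4)`, not squarefree
    have hnsq : ¬ Squarefree D := fun hsq => hnf (Or.inl ⟨h1', hsq, h1⟩)
    obtain ⟨p, hp, E, hE⟩ := Int.exists_prime_sq_dvd_of_not_squarefree hnsq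
    refine ⟨p, hp, E, hE, Or.inr ?_⟩
    -- `p` is odd (`D` is odd), so `p² ≡ 1 (mod 4)` and `E ≡ D ≡ 1 (mod 4)`
    have hodd : (p : ℤ) % 2 = 1 := by
      by_contra h
      have h2 : (2 : ℤ) ∣ (p : ℤ) ^ 2 * E := Dvd.dvd.mul_right (Dvd.dvd.pow (by omega) two_ne_zero) E
      rw [← hE] at h2
      omega
    obtain ⟨q, hq⟩ : ∃ q, (p : ℤ) ^ 2 = 4 * q + 1 := ⟨(p : ℤ) ^ 2 / 4, by have := Int.sq_emod_four_of_odd hodd; omega⟩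
    have : D = 4 * (q * E) + E := by rw [hE, hq]; ring
    omega

namespace RingOfForm

/-! ### `(0, 1, c, d) ∈ U_p` iff `c² − 4d` is fundamental or `1` -/

/-- **`(0, 1, c, d) ∈ U_p` for every prime `p` when `c² − 4d` is fundamental or `1`**: a translate
with `p² ∣ a`, `p ∣ b` would give `c² − 4d = p² E` with `E ≡ 0, 1 (mod 4)`. [folklore] -/
theorem memU_reducibleNormalForm {c d : ℤ}
    (h : (((c ^ 2 - 4 * d) % 4 = 1 ∧ Squarefree (c ^ 2 - 4 * d) ∧ c ^ 2 - 4 * d ≠ 1) ∨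
      (4 ∣ c ^ 2 - 4 * d ∧ ((c ^ 2 - 4 * d) / 4 % 4 = 2 ∨ (c ^ 2 - 4 * d) / 4 % 4 = 3) ∧ Squarefree ((c ^ 2 - 4 * d) / 4)))
      ∨ c ^ 2 - 4 * d = 1)
    {p : ℕ} (hp : p.Prime) : (⟨0, 1, c, d⟩ : BinaryCubic ℤ).MemU p := by
  refine ⟨?_, ?_⟩
  · rintro ⟨-, hb, -, -⟩
    have hu : IsUnit (p : ℤ) := isUnit_of_dvd_one hb
    rw [Int.isUnit_iff_natAbs_eq, Int.natAbs_natCast] at hu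
    exact hp.one_lt.ne' hu
  · rintro ⟨g, hfg, hpa, hpb⟩
    obtain ⟨E, hE, hE4⟩ := exists_disc_eq_sq_mul hpa hpb
    rw [hfg.disc_eq, disc_reducibleNormalForm] at hE
    rcases h with hfund | h1
    · exact Int.not_isFundamental_of_eq_sq_mul hp hE hE4 hfund
    · rw [h1] at hE
      have hu : IsUnit (p : ℤ) := isUnit_of_dvd_one ⟨(p : ℤ) * E, by rw [hE]; ring⟩
      rw [Int.isUnit_iff_natAbs_eq, Int.natAbs_natCast] at hu
      exact hp.one_lt.ne' hu

/-- **`(0, 1, c, d) ∉ U_p` when `c² − 4d = p² E` with `E ≡ 0, 1 (mod 4)`**: with `c' ≡ E (mod 2)`,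
`r = (pc' − c)/2`, one has `r² + cr + d = p² q`, and the shear `u ↦ u + rv` followed by the swap
`u ↔ v` transforms `(0, 1, c, d)` into `±(p² q, p c', 1, 0)`. [folklore] -/
theorem not_memU_reducibleNormalForm {c d E : ℤ} {p : ℕ} (hp : p.Prime) (hD : c ^ 2 - 4 * d = (p : ℤ) ^ 2 * E)
    (hE : E % 4 = 0 ∨ E % 4 = 1) : ¬ (⟨0, 1, c, d⟩ : BinaryCubic ℤ).MemU p := by
  -- `c' ∈ {0, 1}` with `c' ≡ E (mod 2)`
  set c' : ℤ := E % 2 with hc'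
  have hc'01 : c' = 0 ∨ c' = 1 := by omega
  -- parity: `2 ∣ p c' − c`
  have hcpar : c % 2 = (c ^ 2 - 4 * d) % 2 := by have := Int.sq_emod_two c; omega
  have h2 : (2 : ℤ) ∣ (p : ℤ) * c' - c := by
    by_cases hp2 : p = 2
    · subst hp2
      have : c % 2 = 0 := by rw [hcpar, hD]; omega
      omega
    · have hodd : (p : ℤ) % 2 = 1 := by
        have := hp.eq_one_or_self_of_dvd 2
        have h2 : ¬ 2 ∣ p := fun h => hp2 ((this h).resolve_left (by norm_num)).symm
        omega
      obtain ⟨q, hq⟩ : ∃ q, (p : ℤ) ^ 2 = 4 * q + 1 := ⟨(p : ℤ) ^ 2 / 4, by have := Int.sq_emod_four_of_odd hodd; omega⟩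
      have hDE : (c ^ 2 - 4 * d) = 4 * (q * E) + E := by rw [hD, hq]; ring
      obtain ⟨p₀, hp₀⟩ : ∃ p₀, (p : ℤ) = 2 * p₀ + 1 := ⟨(p : ℤ) / 2, by omega⟩
      have hpc : (p : ℤ) * c' = 2 * (p₀ * c') + c' := by rw [hp₀]; ring
      omega
  obtain ⟨r, hr⟩ := h2
  -- `r² + cr + d = p² q`
  have hc'sq : c' ^ 2 = c' := by rcases hc'01 with h | h <;> rw [h] <;> norm_num
  have h4 : (4 : ℤ) ∣ c' - E := by omega
  obtain ⟨q, hq⟩ := h4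
  have hkey : r ^ 2 + c * r + d = (p : ℤ) ^ 2 * q := by
    have h1 : 4 * (r ^ 2 + c * r + d) = (2 * r + c) ^ 2 - (c ^ 2 - 4 * d) := by ring
    have h2 : 2 * r + c = (p : ℤ) * c' := by linarith
    rw [h2, hD] at h1
    have h3 : 4 * (r ^ 2 + c * r + d) = 4 * ((p : ℤ) ^ 2 * q) := by
      rw [h1]; linear_combination ((p : ℤ) ^ 2) * hc'sq + ((p : ℤ) ^ 2) * hq
    linarith
  -- the translate `γ = swap ∘ shear_r`
  intro hU
  apply hU.2
  let γ : Matrix (Fin 2) (Fin 2) ℤ := !![0, 1; 1, 0] * !![1, 0; r, 1]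
  have hdet : γ.det = -1 := by simp [γ, Matrix.det_fin_two_of]
  refine ⟨twist γ ⟨0, 1, c, d⟩, ⟨γ, by rw [hdet]; norm_num, rfl⟩, ?_, ?_⟩
  · refine ⟨-q, ?_⟩
    rw [twist, hdet, subst_mul, subst_shear]
    simp [subst]
    linear_combination -hkey
  · refine ⟨-c', ?_⟩
    rw [twist, hdet, subst_mul, subst_shear]
    simp [subst]
    linarith

/-- **`R((0, 1, c, d))` is maximal iff `c² − 4d` is a fundamental discriminant or `1`**: the
maximal reducible cubic rings are `ℤ × 𝓞_K` (`K` quadratic of discriminant `c² − 4d`) and `ℤ³`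
(BTT 2023, §4); in particular the degenerate `c² = 4d` are never maximal. [cite: BhargavaTaniguchiThorne2023, §4 and Proposition 4.2 (reducible maximal cubic rings ↔ quadratic fields)] -/
theorem isMaximal_reducibleNormalForm_iff {c d : ℤ} :
    IsMaximal (⟨0, 1, c, d⟩ : BinaryCubic ℤ) ↔
      (((c ^ 2 - 4 * d) % 4 = 1 ∧ Squarefree (c ^ 2 - 4 * d) ∧ c ^ 2 - 4 * d ≠ 1) ∨
        (4 ∣ c ^ 2 - 4 * d ∧ ((c ^ 2 - 4 * d) / 4 % 4 = 2 ∨ (c ^ 2 - 4 * d) / 4 % 4 = 3) ∧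
          Squarefree ((c ^ 2 - 4 * d) / 4))) ∨ c ^ 2 - 4 * d = 1 := by
  constructor
  · intro hmax
    by_contra h
    rw [not_or] at h
    have h4 : (c ^ 2 - 4 * d) % 4 = 0 ∨ (c ^ 2 - 4 * d) % 4 = 1 := by
      rw [← disc_reducibleNormalForm]; exact disc_emod_four _
    obtain ⟨p, hp, E, hE, hE4⟩ := Int.exists_prime_sq_dvd_of_not_isFundamental h4 h.2 h.1
    exact not_memU_reducibleNormalForm hp hE hE4 (memU_of_isMaximal hmax hp.one_lt)
  · intro h
    exact isMaximal_of_memU fun p hp => memU_reducibleNormalForm h hp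

/-! ### The orbits of maximal reducible nondegenerate forms ↔ fundamental discriminants ∪ {1} -/

variable {f g : BinaryCubic ℤ}

/-- **A maximal reducible nondegenerate `R(f)` has `Disc(f)` fundamental or `1`** (BTT 2023, §4:
such rings are `ℤ × 𝓞_K`, `Disc = d_K`, or `ℤ³`, `Disc = 1`). [cite: BhargavaTaniguchiThorne2023, §4 (maximal reducible rings ℤ × 𝓞_K and ℤ³)] -/
theorem isFundamental_disc_of_isMaximal (hmax : IsMaximal f) (hred : ¬ f.IsIrreducible) (hdisc : f.disc ≠ 0) :
    ((f.disc % 4 = 1 ∧ Squarefree f.disc ∧ f.disc ≠ 1) ∨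
      (4 ∣ f.disc ∧ (f.disc / 4 % 4 = 2 ∨ f.disc / 4 % 4 = 3) ∧ Squarefree (f.disc / 4))) ∨ f.disc = 1 := by
  obtain ⟨c, d, -, h⟩ := exists_normalForm_of_isMaximal hmax hred hdisc
  have hD : f.disc = c ^ 2 - 4 * d := by rw [← h.disc_eq, disc_reducibleNormalForm]
  rw [hD]
  exact isMaximal_reducibleNormalForm_iff.mp (hmax.of_gl2zEquiv h)

/-- Two normal forms `(0,1,c,d)`, `(0,1,c',d')` with `c, c' ∈ {0,1}` and the same discriminant are
equal (`c ≡ D (mod 2)` and `d = (c² − D)/4`). [folklore] -/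
theorem normalForm_eq_of_disc_eq {c d c' d' : ℤ} (hc : c = 0 ∨ c = 1) (hc' : c' = 0 ∨ c' = 1)
    (h : c ^ 2 - 4 * d = c' ^ 2 - 4 * d') : c = c' ∧ d = d' := by
  rcases hc with rfl | rfl <;> rcases hc' with rfl | rfl <;> constructor <;> omega

/-- **Uniqueness**: two maximal reducible nondegenerate forms with the same discriminant are
`GL₂(ℤ)`-equivalent (one orbit per discriminant). [folklore] -/
theorem gl2zEquiv_of_isMaximal_of_disc_eq (hf : IsMaximal f) (hfr : ¬ f.IsIrreducible) (hg : IsMaximal g)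
    (hgr : ¬ g.IsIrreducible) (hdisc : f.disc ≠ 0) (h : f.disc = g.disc) : GL2ZEquiv f g := by
  obtain ⟨c, d, hc, hfe⟩ := exists_normalForm_of_isMaximal hf hfr hdisc
  obtain ⟨c', d', hc', hge⟩ := exists_normalForm_of_isMaximal hg hgr (h ▸ hdisc)
  have hD : c ^ 2 - 4 * d = c' ^ 2 - 4 * d' := by
    rw [← disc_reducibleNormalForm, ← disc_reducibleNormalForm, hfe.disc_eq, hge.disc_eq, h]
  obtain ⟨rfl, rfl⟩ := normalForm_eq_of_disc_eq hc hc' hD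
  exact hfe.trans hge.symm

/-- **Existence**: every fundamental discriminant `D`, and `D = 1`, is the discriminant of a maximal
reducible nondegenerate form, namely `(0, 1, c, (c² − D)/4)` with `c = D mod 2` (its ring is
`ℤ × 𝓞_{ℚ(√D)}`, resp. `ℤ³`). [folklore] -/
theorem exists_isMaximal_reducible_of_isFundamental {D : ℤ}
    (h : ((D % 4 = 1 ∧ Squarefree D ∧ D ≠ 1) ∨ (4 ∣ D ∧ (D / 4 % 4 = 2 ∨ D / 4 % 4 = 3) ∧ Squarefree (D / 4))) ∨ D = 1) :
    ∃ f : BinaryCubic ℤ, IsMaximal f ∧ ¬ f.IsIrreducible ∧ f.disc = D := by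
  have h4 : D % 4 = 0 ∨ D % 4 = 1 := by
    rcases h with (⟨h1, -, -⟩ | ⟨h4, -, -⟩) | rfl <;> omega
  -- `c = D mod 2`, `d = (c² − D)/4`
  obtain ⟨c, d, hcd⟩ : ∃ c d : ℤ, c ^ 2 - 4 * d = D := by
    rcases h4 with h0 | h1
    · exact ⟨0, -(D / 4), by omega⟩
    · exact ⟨1, -((D - 1) / 4), by omega⟩
  refine ⟨⟨0, 1, c, d⟩, isMaximal_reducibleNormalForm_iff.mpr (by rwa [hcd]),
    not_isIrreducible_of_a_eq_zero rfl, by rw [disc_reducibleNormalForm, hcd]⟩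

end RingOfForm

end Literature.NumberTheory.CubicFields
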